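import Mathlib
import Summits.ResolutionOfSingularities.ResolutionOfSingularities.Theorems.WeightedInvariantLocalWeightedDropTOT2CurveConflictShift

/-!
# `LocalWeightedDrop`, TOT2-LINE regime (P), piece (P3) transport table — CONVERSE OF (F4): no new `u₁`-graphs at the `V(y,u₁)`-curve move

Crux item stmt-ResolutionOfSingularities-8899 `WeightedInvariant.LocalWeightedDrop` (route `ResolutionOfSingularities/WeightedInvariant`), ENGINE
skeleton v34 (80c4710965b6845c), registered stub `stub_regimePresented`, piece (P3) (res-type-088's conflict budget: the «CONVERSE laws — every
datum upstairs comes from a datum downstairs», S-CRV-D-DESIGN.md ADDENDUM v2.5 «remaining converses: translated chart, curve moves, graph move»;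
the u₁-chart origin converse is res-type-088's `graph_of_blowOneT_origin`, …TOT2CurveConflictConverse p549387).  [OURS · L1 W4.3 · chain w43 · seat
res-L1-w43-stub-1 gen 6; def-free; coefficient algebra on `PolyDescent.divOneT` / `shearT` / `WildMonic.shift` with the tree's `divOneT_shift`,
`divOneT_shearT`, `isPermissibleTwoT_shift_killTwo`; nothing here is a statement of any manuscript; AI-produced, gate-checked, weaker than expert
review.]

* `isPermissibleTwoT_of_divOneT` — converse of `isPermissibleTwoT_divOneT` on `V(y,u₁)`-permissible labels (`divOne` is then exact and keeps
  `u₂`-exponents);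
* **`graph_of_divOneT`** — if `V(y,u₁)` is permissible for `A` and the curve chart `divOneT d A` carries a permissible graph curve with datum `h`
  (any re-centring `φ′`), then `A` carries a permissible graph curve with the SAME datum `h` (re-centring `u₁ · φ′(u₁,0)`); with (F4)
  `graph_divOneT` the u₁-graph data of `A` and of `divOneT d A` are the same set;
* `hasGraphCurveT_of_divOneT` — predicate form.
-/

set_option linter.dupNamespace false -- mandated namespace of this single-conjunct summit

noncomputable section

namespace Summit.ResolutionOfSingularities.ResolutionOfSingularities.Theorems

namespace TOT2Curve

open MvPowerSeries PolyDescent MonicDescent WildMonic Literature.AlgebraicGeometry.Resolution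

variable {k : Type} [Field k] {d : ℕ}

/-- Converse of `isPermissibleTwoT_divOneT`: on a `V(y,u₁)`-permissible label, `divOneT` is exact and keeps the `u₂`-exponents, so
`V(y,u₂)`-permissibility upstairs gives it downstairs. -/
theorem isPermissibleTwoT_of_divOneT {B : Fin d → MvPowerSeries (Fin 2) k} (hB1 : IsPermissibleOneT d B) (h : IsPermissibleTwoT d (divOneT d B)) :
    IsPermissibleTwoT d B := by
  intro j e he
  have hle : d - (j : ℕ) ≤ e 0 := hB1 j e he
  have hsplit : e - Finsupp.single 0 (d - (j : ℕ)) + Finsupp.single 0 (d - (j : ℕ)) = e :=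
    tsub_add_cancel_of_le (Finsupp.single_le_iff.mpr hle)
  have he' : coeff (e - Finsupp.single 0 (d - (j : ℕ))) (divOneT d B j) ≠ 0 := by
    show coeff (e - Finsupp.single 0 (d - (j : ℕ))) (divOne (d - (j : ℕ)) (B j)) ≠ 0
    rwa [coeff_divOne, hsplit]
  have h1 := h j _ he'
  simpa using h1

/-- **CONVERSE OF (F4) — NO NEW `u₁`-GRAPHS AT THE `V(y,u₁)`-MOVE.**  If `V(y,u₁)` is permissible for `A` and the curve chart `divOneT d A` carries a
permissible graph curve `V(y + φ′, u₂ + u₁h)`, then `A` carries the permissible graph curve `V(y + u₁·φ′(u₁,0), u₂ + u₁h)`: the same datum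
`h` (cf. (F4) `graph_divOneT`). -/
theorem graph_of_divOneT (A : Fin d → MvPowerSeries (Fin 2) k) (hA1 : IsPermissibleOneT d A) (h φ' : MvPowerSeries (Fin 2) k)
    (hperm' : IsPermissibleTwoT d (shift d (shearT h (divOneT d A)) φ')) :
    ∃ φ : MvPowerSeries (Fin 2) k, constantCoeff φ = 0 ∧ IsPermissibleTwoT d (shift d (shearT h A) φ) := by
  -- the `u₂`-free presentation upstairs
  set φ₀ := subst (![X 0, 0] : Fin 2 → MvPowerSeries (Fin 2) k) φ' with hφ₀
  have hperm₀ : IsPermissibleTwoT d (shift d (shearT h (divOneT d A)) φ₀) := isPermissibleTwoT_shift_killTwo hperm'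
  -- push the shear and the re-centring downstairs
  have hB1 : IsPermissibleOneT d (shearT h A) := isPermissibleOneT_shearT h hA1
  have hcomm : divOneT d (shift d (shearT h A) (X 0 * φ₀)) = shift d (shearT h (divOneT d A)) φ₀ := by
    rw [divOneT_shift _ _ hB1, divOneT_shearT h hA1]
  rw [← hcomm] at hperm₀
  refine ⟨X 0 * φ₀, by rw [map_mul, constantCoeff_X, zero_mul], ?_⟩
  exact isPermissibleTwoT_of_divOneT (isPermissibleOneT_shift_X_mul hB1 φ₀) hperm₀

/-- Predicate form: a graph curve of `divOneT d A` (for `V(y,u₁)`-permissible `A`) comes from a graph curve of `A` with the same datum. -/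
theorem hasGraphCurveT_of_divOneT (A : Fin d → MvPowerSeries (Fin 2) k) (hA1 : IsPermissibleOneT d A) (hG : HasGraphCurveT d (divOneT d A)) :
    HasGraphCurveT d A := by
  obtain ⟨h, φ', hh, -, hperm'⟩ := hG
  obtain ⟨φ, hφ, hperm⟩ := graph_of_divOneT A hA1 h φ' hperm'
  exact ⟨h, φ, hh, hφ, hperm⟩

/-- **THE u₁-GRAPH DATA ARE INVARIANT UNDER THE `V(y,u₁)`-MOVE** (for a position with `V(y,u₁)` permissible): (F4) and its converse. -/
theorem graphData_divOneT_eq (hd : 0 < d) (A : Fin d → MvPowerSeries (Fin 2) k) (hA : IsPosT d A) (hA1 : IsPermissibleOneT d A) :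
    {h : MvPowerSeries (Fin 2) k | (∀ e : Fin 2 →₀ ℕ, e 1 ≠ 0 → coeff e h = 0) ∧
        ∃ φ : MvPowerSeries (Fin 2) k, constantCoeff φ = 0 ∧ IsPermissibleTwoT d (shift d (shearT h (divOneT d A)) φ)} =
      {h : MvPowerSeries (Fin 2) k | (∀ e : Fin 2 →₀ ℕ, e 1 ≠ 0 → coeff e h = 0) ∧
        ∃ φ : MvPowerSeries (Fin 2) k, constantCoeff φ = 0 ∧ IsPermissibleTwoT d (shift d (shearT h A) φ)} := by
  ext h
  constructor
  · rintro ⟨hh, φ', -, hperm'⟩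
    exact ⟨hh, graph_of_divOneT A hA1 h φ' hperm'⟩
  · rintro ⟨hh, φ, hφ, hperm⟩
    exact ⟨hh, graph_divOneT hd A hA hA1 h φ hφ hperm⟩

end TOT2Curve

end Summit.ResolutionOfSingularities.ResolutionOfSingularities.Theorems

end
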